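import Mathlib
import Literature.Combinatorics.Optimization.SymmetricLpVersusSheraliAdams
import Literature.Combinatorics.Optimization.PolySizeLpIntegralityGaps
import HarnessLib

/-!
# Exponential lower bounds for SYMMETRIC LP relaxations of Max-CSPs from linear-round Sherali–Adams
# gaps (Chan–Lee–Raghavendra–Steurer 2013/2016, §4) — UNCONDITIONAL consequences of Theorem 4.1

[ChanEtAl2016, §1 (arXiv v3 p. 3)]: "§4 contains an illustrative discussion of how Sherali–Adams gap
examples can be used to construct corresponding gaps for symmetric LPs.  This connection is
quantitatively stronger than our result for general LPs."  Theorem 4.1 (PROVED in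
`SymmetricLpVersusSheraliAdams.lean`, `ChanEtAl2016_thm41`) turns a `d`-round Sherali–Adams gap on `m`
variables into the failure of every symmetric LP relaxation of size `< \binom{2m}{d}` on `2m`
variables; fed with the LINEAR-round gaps `d = ⌊c_ε m⌋` of [Schoenebeck08] (PROVED in the tree:
`Schoenebeck2008_maxKSatSA`, `Schoenebeck2008_maxKXorSA`, `Schoenebeck2008_parityImplied_SA`) this is
a size lower bound `\binom{2m}{⌊c m⌋} = 2^{Ω(m)}` — exponential, versus the quasi-polynomial bound of
Theorem 3.2 for general LPs.

Contents (theorems only, 0 named facts): `symmetric_lp_of_linearSAGap` (generic), its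
integrality-gap form `symmetric_lpGap_of_linearSAGap`, and the UNCONDITIONAL instances
`maxKSat_symmetric_lp(Gap)`, `maxKXor_symmetric_lp(Gap)`, `parityImplied_symmetric_lp` (`k ≥ 3`).
-/

noncomputable section

open Finset

namespace Literature.Combinatorics.Optimization

/-- **Symmetric LPs do not beat linear-round Sherali–Adams gaps, at exponential size (UNCONDITIONAL
given the gap).**  If for every `ε > 0` the `⌊c_ε n⌋`-round Sherali–Adams relaxation of Max-`𝒫` fails
to `(1 − ε, s₀ + ε)`-approximate for all large `n`, then for every `ε > 0` there are `c' > 0` and `n₀`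
such that for all `n ≥ n₀`, no SYMMETRIC LP relaxation on `2n` variables of size
`R < \binom{2n}{⌊c' n⌋}` achieves a `(1 − ε, s₀ + ε)`-approximation.
[cite: ChanEtAl2016, Thm 4.1 (arXiv v3 p. 12) with §1 (p. 3: "quantitatively stronger than our result for general LPs")] -/
theorem symmetric_lp_of_linearSAGap {k : ℕ} (P : Set ((Fin k → Bool) → Bool)) {s₀ : ℝ}
    (hSAgap : ∀ ε : ℝ, 0 < ε → ∃ cε : ℝ, 0 < cε ∧ ∃ n₀ : ℕ, ∀ n : ℕ, n₀ ≤ n →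
      ¬ SAAchieves (n := n) P ⌊cε * n⌋₊ (1 - ε) (s₀ + ε))
    {ε : ℝ} (hε : 0 < ε) :
    ∃ c' : ℝ, 0 < c' ∧ ∃ n₀ : ℕ, ∀ n : ℕ, n₀ ≤ n →
      ∀ R : ℕ, R < (n + n).choose ⌊c' * n⌋₊ →
        ∀ L : LPRelaxation k (n + n) P R, L.IsSymmetric → ¬ L.Achieves (1 - ε) (s₀ + ε) := by
  obtain ⟨cε, hcε, n₁, H⟩ := hSAgap ε hε
  set c' : ℝ := min cε (1 / 2) with hc'
  have hc'0 : 0 < c' := lt_min hcε (by norm_num)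
  have hc'ε : c' ≤ cε := min_le_left _ _
  have hc'2 : c' ≤ 1 / 2 := min_le_right _ _
  refine ⟨c', hc'0, max n₁ (max 5 ⌈1 / c'⌉₊), fun n hn R hR L hL => ?_⟩
  have hn₁ : n₁ ≤ n := le_trans (le_max_left _ _) hn
  have hn5 : 5 ≤ n := le_trans ((le_max_left _ _).trans (le_max_right _ _)) hn
  have hnc : ⌈1 / c'⌉₊ ≤ n := le_trans ((le_max_right _ _).trans (le_max_right _ _)) hn
  have hn0 : (0 : ℝ) ≤ n := Nat.cast_nonneg n
  -- `d = ⌊c' n⌋` satisfies `1 ≤ d ≤ ⌊c_ε n⌋` and `2d ≤ n`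
  have hd1 : 1 ≤ ⌊c' * n⌋₊ := by
    refine Nat.le_floor ?_
    have h1 : (1 : ℝ) / c' ≤ n := le_trans (Nat.le_ceil _) (by exact_mod_cast hnc)
    calc ((1 : ℕ) : ℝ) = c' * (1 / c') := by rw [Nat.cast_one]; field_simp
      _ ≤ c' * n := by gcongr
  have hdle : ⌊c' * n⌋₊ ≤ ⌊cε * n⌋₊ := Nat.floor_le_floor (by nlinarith)
  have h2d : 2 * ⌊c' * n⌋₊ ≤ n := by
    have h : (⌊c' * n⌋₊ : ℝ) ≤ c' * n := Nat.floor_le (by positivity)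
    have h2 : (2 * ⌊c' * n⌋₊ : ℝ) ≤ n := by nlinarith
    exact_mod_cast h2
  exact ChanEtAl2016_thm41 (by omega) hd1 h2d (not_saAchieves_of_le (H n hn₁) hdle) hR L hL

/-- **Integrality-gap form**: under the same linear-round Sherali–Adams gap with `0 < s₀ < 1`, for every
`ε > 0` there are `c' > 0`, `n₀` with: for `n ≥ n₀`, no symmetric LP relaxation on `2n` variables of size
`< \binom{2n}{⌊c' n⌋}` has integrality gap `< 1/s₀ − ε`.
[cite: ChanEtAl2016, Thm 4.1 (arXiv v3 p. 12) with §2 (p. 6: "α-factor approximation")] -/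
theorem symmetric_lpGap_of_linearSAGap {k : ℕ} (P : Set ((Fin k → Bool) → Bool)) {s₀ : ℝ}
    (hs₀ : 0 < s₀) (hs₁ : s₀ < 1)
    (hSAgap : ∀ ε : ℝ, 0 < ε → ∃ cε : ℝ, 0 < cε ∧ ∃ n₀ : ℕ, ∀ n : ℕ, n₀ ≤ n →
      ¬ SAAchieves (n := n) P ⌊cε * n⌋₊ (1 - ε) (s₀ + ε))
    {ε : ℝ} (hε : 0 < ε) :
    ∃ c' : ℝ, 0 < c' ∧ ∃ n₀ : ℕ, ∀ n : ℕ, n₀ ≤ n →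
      ∀ R : ℕ, R < (n + n).choose ⌊c' * n⌋₊ →
        ∀ L : LPRelaxation k (n + n) P R, L.IsSymmetric → ¬ L.GapLT (1 / s₀ - ε) := by
  -- WLOG `ε ≤ 1`; margin `δ = ε' s₀² / 2`
  set ε' : ℝ := min ε 1 with hε'
  have hε'0 : 0 < ε' := lt_min hε one_pos
  have hε'1 : ε' ≤ 1 := min_le_right _ _
  have hε'ε : ε' ≤ ε := min_le_left _ _
  set δ : ℝ := ε' * s₀ ^ 2 / 2 with hδ
  have hδ0 : 0 < δ := by rw [hδ]; positivity
  have hs₀2 : s₀ ^ 2 ≤ s₀ := by nlinarith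
  have hδ1 : δ ≤ 1 / 2 := by
    rw [hδ]
    have : ε' * s₀ ^ 2 ≤ 1 * 1 := by nlinarith
    linarith
  obtain ⟨c', hc', n₀, hn₀⟩ := symmetric_lp_of_linearSAGap P hSAgap hδ0
  refine ⟨c', hc', n₀, fun n hn R hR L hL hgap => hn₀ n hn R hR L hL ?_⟩
  refine (hgap.mono (show 1 / s₀ - ε ≤ 1 / s₀ - ε' by linarith)).achieves (by linarith) ?_
    (by linarith)
  have h1 : (1 / s₀ - ε') * (s₀ + δ) = 1 + δ / s₀ - ε' * s₀ - ε' * δ := by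
    field_simp
    ring
  rw [h1]
  have h2 : δ / s₀ = ε' * s₀ / 2 := by
    rw [hδ]; field_simp
  rw [h2]
  have h3 : 0 ≤ ε' * δ := by positivity
  nlinarith

/-- **Max-`k`-SAT, `k ≥ 3`: symmetric LP relaxations of size `< \binom{2n}{⌊c n⌋} = 2^{Ω(n)}` cannot
`(1 − ε, 1 − 2^{−k} + ε)`-approximate** (UNCONDITIONAL).
[cite: ChanEtAl2016, Thm 4.1 (arXiv v3 p. 12)] -/
theorem maxKSat_symmetric_lp {k : ℕ} (hk : 3 ≤ k) {ε : ℝ} (hε : 0 < ε) :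
    ∃ c' : ℝ, 0 < c' ∧ ∃ n₀ : ℕ, ∀ n : ℕ, n₀ ≤ n →
      ∀ R : ℕ, R < (n + n).choose ⌊c' * n⌋₊ →
        ∀ L : LPRelaxation k (n + n) (maxKSatPreds k) R, L.IsSymmetric →
          ¬ L.Achieves (1 - ε) (1 - 1 / 2 ^ k + ε) :=
  symmetric_lp_of_linearSAGap (maxKSatPreds k) (Schoenebeck2008_maxKSatSA hk) hε

/-- **Max-`k`-SAT, `k ≥ 3`, integrality-gap form**: symmetric LPs of size `< \binom{2n}{⌊c n⌋}` have
integrality gap at least `2^k/(2^k−1) − ε` (`k = 3`: `8/7 − ε`), UNCONDITIONAL.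
[cite: ChanEtAl2016, Thm 4.1 (arXiv v3 p. 12) and §1 (p. 3)] -/
theorem maxKSat_symmetric_lpGap {k : ℕ} (hk : 3 ≤ k) {ε : ℝ} (hε : 0 < ε) :
    ∃ c' : ℝ, 0 < c' ∧ ∃ n₀ : ℕ, ∀ n : ℕ, n₀ ≤ n →
      ∀ R : ℕ, R < (n + n).choose ⌊c' * n⌋₊ →
        ∀ L : LPRelaxation k (n + n) (maxKSatPreds k) R, L.IsSymmetric →
          ¬ L.GapLT ((2 : ℝ) ^ k / (2 ^ k - 1) - ε) := by
  have h2k : (8 : ℝ) ≤ 2 ^ k := by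
    calc (8 : ℝ) = 2 ^ 3 := by norm_num
      _ ≤ 2 ^ k := pow_le_pow_right₀ one_le_two hk
  have hs₀ : (0 : ℝ) < 1 - 1 / 2 ^ k := by
    rw [sub_pos, div_lt_one (by positivity)]; linarith
  have hs₁ : (1 : ℝ) - 1 / 2 ^ k < 1 := by
    have : (0 : ℝ) < 1 / 2 ^ k := by positivity
    linarith
  obtain ⟨c', hc', n₀, hn₀⟩ := symmetric_lpGap_of_linearSAGap (maxKSatPreds k) hs₀ hs₁
    (Schoenebeck2008_maxKSatSA hk) hε
  refine ⟨c', hc', n₀, fun n hn R hR L hL => ?_⟩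
  have h := hn₀ n hn R hR L hL
  have hne : (2 : ℝ) ^ k - 1 ≠ 0 := by linarith
  rwa [show (1 : ℝ) / (1 - 1 / 2 ^ k) = 2 ^ k / (2 ^ k - 1) by field_simp] at h

/-- **Max-`k`-XOR, `k ≥ 3`: symmetric LP relaxations of size `< \binom{2n}{⌊c n⌋}` cannot
`(1 − ε, 1/2 + ε)`-approximate** (UNCONDITIONAL). [cite: ChanEtAl2016, Thm 4.1 (arXiv v3 p. 12)] -/
theorem maxKXor_symmetric_lp {k : ℕ} (hk : 3 ≤ k) {ε : ℝ} (hε : 0 < ε) :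
    ∃ c' : ℝ, 0 < c' ∧ ∃ n₀ : ℕ, ∀ n : ℕ, n₀ ≤ n →
      ∀ R : ℕ, R < (n + n).choose ⌊c' * n⌋₊ →
        ∀ L : LPRelaxation k (n + n) (literalClosure (xorK k)) R, L.IsSymmetric →
          ¬ L.Achieves (1 - ε) (1 / 2 + ε) :=
  symmetric_lp_of_linearSAGap _ (Schoenebeck2008_maxKXorSA hk) hε

/-- **Max-`k`-XOR, `k ≥ 3`, integrality-gap form**: symmetric LPs of size `< \binom{2n}{⌊c n⌋}` have
integrality gap at least `2 − ε`, UNCONDITIONAL. [cite: ChanEtAl2016, Thm 4.1 (arXiv v3 p. 12)] -/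
theorem maxKXor_symmetric_lpGap {k : ℕ} (hk : 3 ≤ k) {ε : ℝ} (hε : 0 < ε) :
    ∃ c' : ℝ, 0 < c' ∧ ∃ n₀ : ℕ, ∀ n : ℕ, n₀ ≤ n →
      ∀ R : ℕ, R < (n + n).choose ⌊c' * n⌋₊ →
        ∀ L : LPRelaxation k (n + n) (literalClosure (xorK k)) R, L.IsSymmetric →
          ¬ L.GapLT (2 - ε) := by
  obtain ⟨c', hc', n₀, hn₀⟩ := symmetric_lpGap_of_linearSAGap (literalClosure (xorK k))
    (s₀ := 1 / 2) (by norm_num) (by norm_num) (Schoenebeck2008_maxKXorSA hk) hε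
  refine ⟨c', hc', n₀, fun n hn R hR L hL => ?_⟩
  have h := hn₀ n hn R hR L hL
  rwa [show (1 : ℝ) / (1 / 2) - ε = 2 - ε by norm_num] at h

/-- **Parity-implied predicates, `k ≥ 3`: symmetric LP relaxations of size `< \binom{2n}{⌊c n⌋}` do not
beat the random-assignment threshold** (UNCONDITIONAL). [cite: ChanEtAl2016, Thm 4.1 (arXiv v3 p. 12)] -/
theorem parityImplied_symmetric_lp {k : ℕ} (hk : 3 ≤ k) {Q : (Fin k → Bool) → Bool}
    (hQ : ∀ y, xorK k y = true → Q y = true) {ε : ℝ} (hε : 0 < ε) :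
    ∃ c' : ℝ, 0 < c' ∧ ∃ n₀ : ℕ, ∀ n : ℕ, n₀ ≤ n →
      ∀ R : ℕ, R < (n + n).choose ⌊c' * n⌋₊ →
        ∀ L : LPRelaxation k (n + n) (literalClosure Q) R, L.IsSymmetric →
          ¬ L.Achieves (1 - ε) (((univ : Finset (Fin k → Bool)).filter fun y => Q y = true).card / 2 ^ k + ε) :=
  symmetric_lp_of_linearSAGap _ (Schoenebeck2008_parityImplied_SA hk hQ) hε

end Literature.Combinatorics.Optimization

end
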